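import Literature.MathematicalPhysics.KineticTheory.HardSphereEuler
import Literature.Analysis.FunctionSpaces.TorusSpaceTime

/-!
# Negative knowledge for `KineticWindowGronwall` (stmt-AtomisticToContinuum-9282), VI: static contact laminates are
classical hard-sphere-Euler solutions for every equation of state

From the standing disprover's `Cruxes/KineticWindowGronwall/Disproof.lean` §12 (cycle 3,
refuter-cdisprove-stmt-AtomisticToContinuum-9282-g3-0), fact (L3) of the laminate witness against the picked line's
`MesoJammedSetLd`, and §13.1 (the shape of the EOS wall in front of `¬RelEntropyVanishing`):

* `isHardSphereEulerSolution_static_isobaric`: any smooth, positive, time-independent pair `(ρ₀, θ₀)` on `𝕋³` with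
  spatially CONSTANT hard-sphere pressure `hsPressure σ (ρ₀ x) (θ₀ x) = p₀` and zero velocity is an
  `IsHardSphereEulerSolution σ T` for every `σ, T` — no property of `hsCompressibility` is used (pressure-balanced
  density/temperature layers at rest: contact discontinuities, smoothed, are exact steady solutions of the compressible
  Euler system whatever the equation of state);
* `isHardSphereEulerSolution_static_sigma_zero`: at the degenerate parameter `σ = 0` (`Z(0) = 1`) the class is
  therefore inhabited by NON-CONSTANT densities, `(ρ₀, 0, p₀/ρ₀)`; at `σ > 0` the same profiles need smoothness of
  `hsCompressibility` on the range of `ρ₀σ³` (item 0768) — every classical solution certified in the tree at `σ > 0`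
  has constant density.
Pure theorems about the hypothesis class of the consequent (and of 3091, 9235, 9518, 9519, `HighMomentumCutoff`);
no positive Theses conclusion.
-/

noncomputable section

namespace Summit.AtomisticToContinuum.HydrodynamicLimit.Theorems.KineticWindowGronwallNegative

open Set
open Literature.MathematicalPhysics.KineticTheory Literature.Analysis.FluidPDE
open Literature.Analysis.FunctionSpaces

/-- **Contact laminates at rest are exact classical hs-Euler solutions, for EVERY equation of state.** Any smooth,
positive, time-independent density/temperature pair `(ρ₀, θ₀)` on `𝕋³` with spatially constant hard-sphere pressure
`ρ₀ θ₀ Z(ρ₀σ³) ≡ p₀` and zero velocity solves the hard-sphere compressible Euler system on every `[0, T)`: all time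
derivatives vanish, every flux is a multiple of `u ≡ 0`, and `∇p = ∇(const) = 0`. [folklore] -/
theorem isHardSphereEulerSolution_static_isobaric (σ T p₀ : ℝ) {ρ₀ θ₀ : T3 → ℝ}
    (hρ : Torus.IsSmooth ρ₀) (hθ : Torus.IsSmooth θ₀) (hρ0 : ∀ x, 0 < ρ₀ x) (hθ0 : ∀ x, 0 < θ₀ x)
    (hp : ∀ x, hsPressure σ (ρ₀ x) (θ₀ x) = p₀) :
    IsHardSphereEulerSolution σ T (fun _ => ρ₀) (fun _ _ => 0) (fun _ => θ₀) where
  smooth_density := Torus.isSmoothSpaceTimeOn_const hρ _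
  smooth_velocity := Torus.isSmoothSpaceTimeOn_const (Torus.isSmooth_const _) _
  smooth_temperature := Torus.isSmoothSpaceTimeOn_const hθ _
  density_pos _ _ x := hρ0 x
  temperature_pos _ _ x := hθ0 x
  mass t _ x := by
    simp [Torus.timeDerivWithin, Torus.divergence, Torus.partialDeriv, Torus.lineDeriv]
  momentum t _ x := by
    have hfun : (fun y => hsPressure σ (ρ₀ y) (θ₀ y)) = fun _ => p₀ := funext hp
    rw [hfun]
    unfold Torus.gradient Torus.liftAt
    simp [Torus.timeDerivWithin, Torus.partialDeriv, Torus.lineDeriv, _root_.gradient]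
  energy t _ x := by
    simp [Torus.timeDerivWithin, Torus.divergence, Torus.partialDeriv, Torus.lineDeriv]

/-- **The class is non-trivially inhabited at the degenerate parameter `σ = 0`** (`Z(ρ·0) = Z(0) = 1 + 0·deriv _ 0 = 1`):
for every smooth positive density `ρ₀` and pressure level `p₀ > 0`, `(ρ₀, 0, p₀/ρ₀)` is a classical solution on every
`[0,T)` — a certified NON-CONSTANT-density member of `IsHardSphereEulerSolution 0 T`. [folklore] -/
theorem isHardSphereEulerSolution_static_sigma_zero (T : ℝ) {p₀ : ℝ} (hp₀ : 0 < p₀) {ρ₀ : T3 → ℝ}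
    (hρ : Torus.IsSmooth ρ₀) (hρ0 : ∀ x, 0 < ρ₀ x) :
    IsHardSphereEulerSolution 0 T (fun _ => ρ₀) (fun _ _ => 0) (fun _ x => p₀ / ρ₀ x) := by
  have hθ : Torus.IsSmooth (fun x => p₀ / ρ₀ x) := by
    unfold Torus.IsSmooth at hρ ⊢
    exact contDiff_const.div hρ fun y => (hρ0 _).ne'
  refine isHardSphereEulerSolution_static_isobaric 0 T p₀ hρ hθ hρ0 (fun x => div_pos hp₀ (hρ0 x)) fun x => ?_
  simp only [hsPressure, hsCompressibility]
  have hx : (ρ₀ x) ≠ 0 := (hρ0 x).ne'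
  field_simp
  ring

end Summit.AtomisticToContinuum.HydrodynamicLimit.Theorems.KineticWindowGronwallNegative

end
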